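import Summits.ResolutionOfSingularities.ResolutionOfSingularities.Theorems.EquisingularLiftEquisingularLiftNatTransitionKernelCharts
import Summits.ResolutionOfSingularities.ResolutionOfSingularities.Theorems.EquisingularLiftEquisingularLiftNatLiftOfIdealSheafData
import Summits.ResolutionOfSingularities.ResolutionOfSingularities.Theorems.EquisingularLiftEquisingularLiftNatComapOnCharts
import Literature.AlgebraicGeometry.Morphisms.FormalFunctions
import HarnessLib

/-!
# [OURS · L1 W4.5(b) · EL♮(3) · J1c (π) brick F5a] Special-fibre charts of the infinitesimal neighbourhoods

Crux chain w45b (cell `res-hironaka`, slot W4.5(b)), child crux **EL♮(3)** = stmt-ResolutionOfSingularities-20148; J1 = `EmbeddedInfinitesimalLiftFact`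
(p596985), discharge programme J1c, brick **(π)** (patching engine, res-type-027 g17). OURS; NOT a statement of H. Hironaka's 2017 manuscript; AI-written,
gate-checked, weaker than expert review. No `sorry`; standard axioms. ONE definition (`fibreEmb`, review lane). `--supports stmt-ResolutionOfSingularities-20148 --as helper`.

The scheme-level dictionary the patching engine F6 uses to instantiate the abstract chart torsor F5 (`A' := Γ(X_m, U)`, `π := (fibreEmb m)♯_U`):
for `f : X ⟶ Spec A`, an ideal `I ⊆ A`, a surjection `q : A ↠ k₀` with `ker q = I`, and ANY model `j₀ : X₀ ⟶ X`, `t₀ : X₀ ⟶ Spec k₀` of the fibre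
(`IsPullback j₀ t₀ f (Spec q)` — J1's `(jW, tW)`):
* `fibreEmb m : X₀ ⟶ X_m` — the closed immersion of the fibre model into the `m`-th infinitesimal neighbourhood (the tree's `toInfinitesimalNeighbourhood`,
  `Morphisms/FormalFunctions`, transported along `hsq.isoPullback`): `fibreEmb_ι`, `fibreEmb_transition`, `isClosedImmersion_fibreEmb`, `surjective_fibreEmb`,
  `isPullback_fibreEmb` (it is the base change of `Spec k₀ → Spec (A ⧸ I^{m+1})`);
* `ker_fibreRingHom`, `ker_app_fibreEmb` — on an affine chart `U ⊆ X_m`, `ker ((fibreEmb m)♯_U) = (I/I^{m+1})·Γ(X_m, U)` (stub-4's D1 lemma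
  `ker_app_eq_map_of_isPullback_specMap`, p-file …NatTransitionKernelCharts);
* `isPullback_fibreEmb_of_isPullback_ι`, `ker_comap_fibreEmb`, `map_app_fibreEmb_eq_ker_ideal` — D4: for a closed `jn : Yₘ ⟶ X_m` with
  `Y₀ = Yₘ ×_X X₀` (J1's `hs₀`), `jn.ker.comap (fibreEmb m) = ι.ker` and, on charts, `(jn.ker.ideal U)·Γ(X₀, fibreEmb⁻¹U) = 𝓘_{Y₀}(fibreEmb⁻¹U)`;
* `complOpens`, `preimage_complOpens`, `mem_complOpens_of_not_mem_range`, `base_mem_complOpens` — topology of a closed immersion `e : Y ⟶ X`: the open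
  `X ∖ e(Y ∖ O)` has preimage `O` (used to shrink charts into the traces `V j` of J1's two-piece cover).

References (method / index only): R. Hartshorne, *Deformation Theory* (2010), §6 (setting of Thm. 6.2); The Stacks Project, Tag 02OC (infinitesimal neighbourhoods).
-/

set_option linter.dupNamespace false -- mandated namespace `Summit.<Summit>.<Problem>` of this single-conjunct summit

noncomputable section

open CategoryTheory CategoryTheory.Limits AlgebraicGeometry Opposite TopologicalSpace
open Literature.AlgebraicGeometry.Morphisms

namespace Summit.ResolutionOfSingularities.ResolutionOfSingularities.Cruxes.EquisingularLiftNat.Sections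

/-! ## The fibre model inside the infinitesimal neighbourhoods -/

section Fibre

variable {A : Type} [CommRing A] (I : Ideal A) {X : Scheme.{0}} (f : X ⟶ Spec (.of A)) {k₀ : Type} [CommRing k₀] (q : A →+* k₀)
  (hI : I ≤ RingHom.ker q) {X₀ : Scheme.{0}} {j₀ : X₀ ⟶ X} {t₀ : X₀ ⟶ Spec (.of k₀)}
  (hsq : IsPullback j₀ t₀ f (Spec.map (CommRingCat.ofHom q)))

/-- **The fibre model inside the `m`-th infinitesimal neighbourhood**: `X₀ ≅ X ×_A k₀ ⟶ X_m = X ×_A A/I^{m+1}` (the tree's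
`toInfinitesimalNeighbourhood` transported along the model square `hsq`). [cite: StacksProject, Tag 02OC (infinitesimal neighbourhoods)] -/
def fibreEmb (m : ℕ) : X₀ ⟶ infinitesimalNeighbourhood I f m :=
  hsq.isoPullback.hom ≫ toInfinitesimalNeighbourhood I f q hI m

/-- `X₀ → X_m → X` is the model map `j₀`. [folklore] -/
@[reassoc]
theorem fibreEmb_ι (m : ℕ) : fibreEmb I f q hI hsq m ≫ infinitesimalNeighbourhood.ι I f m = j₀ := by
  rw [fibreEmb, Category.assoc, toInfinitesimalNeighbourhood_ι, IsPullback.isoPullback_hom_fst]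

/-- `X₀ → X_m → Spec (A ⧸ I^{m+1})` is `t₀` followed by `Spec (A ⧸ I^{m+1} → k₀)`. [folklore] -/
@[reassoc]
theorem fibreEmb_toSpec (m : ℕ) : fibreEmb I f q hI hsq m ≫ infinitesimalNeighbourhood.toSpec I f m =
    t₀ ≫ Spec.map (CommRingCat.ofHom (fibreRingHom I q hI m)) := by
  rw [fibreEmb, Category.assoc, toInfinitesimalNeighbourhood_toSpec, IsPullback.isoPullback_hom_snd_assoc]

/-- The fibre embeddings are compatible with the transition maps. [folklore] -/
@[reassoc]
theorem fibreEmb_transition (m : ℕ) :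
    fibreEmb I f q hI hsq m ≫ infinitesimalNeighbourhood.transition I f m = fibreEmb I f q hI hsq (m + 1) := by
  rw [fibreEmb, fibreEmb, Category.assoc, toInfinitesimalNeighbourhood_transition]

/-- **`X₀ → X_m` is the base change of `Spec k₀ → Spec (A ⧸ I^{m+1})`.** [folklore] -/
theorem isPullback_fibreEmb (m : ℕ) : IsPullback (fibreEmb I f q hI hsq m) t₀ (infinitesimalNeighbourhood.toSpec I f m)
    (Spec.map (CommRingCat.ofHom (fibreRingHom I q hI m))) := by
  have h := isPullback_toInfinitesimalNeighbourhood I f q hI m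
  refine IsPullback.of_iso h hsq.isoPullback.symm (Iso.refl _) (Iso.refl _) (Iso.refl _) ?_ ?_ (by simp) (by simp)
  · rw [fibreEmb, Iso.refl_hom, Category.comp_id, Iso.symm_hom, Iso.inv_hom_id_assoc]
  · rw [Iso.refl_hom, Category.comp_id, Iso.symm_hom, IsPullback.isoPullback_inv_snd]

/-- `X₀ → X_m` is a closed immersion when `q` is surjective. [folklore] -/
theorem isClosedImmersion_fibreEmb (hq : Function.Surjective q) (m : ℕ) : IsClosedImmersion (fibreEmb I f q hI hsq m) := by
  haveI : Fact (Function.Surjective q) := ⟨hq⟩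
  rw [fibreEmb]
  infer_instance

/-- `X₀ → X_m` is surjective when `ker q = I` (same underlying space). [folklore] -/
theorem surjective_fibreEmb (hq : Function.Surjective q) (hI' : RingHom.ker q ≤ I) (m : ℕ) : Surjective (fibreEmb I f q hI hsq m) := by
  haveI := surjective_toInfinitesimalNeighbourhood I f q hI hq hI' m
  rw [fibreEmb]
  infer_instance

/-- `ker (A ⧸ I^{m+1} → k₀) = (ker q)/I^{m+1}`. [folklore] -/
theorem ker_fibreRingHom (m : ℕ) : RingHom.ker (fibreRingHom I q hI m) = (RingHom.ker q).map (Ideal.Quotient.mk (I ^ (m + 1))) :=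
  Ideal.ker_quotient_lift _ _

/-- **The kernel of `(fibreEmb m)♯` on an affine chart `U ⊆ X_m` is the extended ideal `((ker q)/I^{m+1})·Γ(X_m, U)`** (base change of the closed
immersion `Spec k₀ → Spec (A ⧸ I^{m+1})`; stub-4's `ker_app_eq_map_of_isPullback_specMap`). [cite: GortzWedhorn2020, Example 4.36 (p. 139)] -/
theorem ker_app_fibreEmb (hq : Function.Surjective q) (m : ℕ) (U : (infinitesimalNeighbourhood I f m).affineOpens) :
    RingHom.ker ((fibreEmb I f q hI hsq m).app (U : (infinitesimalNeighbourhood I f m).Opens)).hom =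
      (((RingHom.ker q).map (Ideal.Quotient.mk (I ^ (m + 1)))).comap (Scheme.ΓSpecIso (.of (A ⧸ I ^ (m + 1)))).hom.hom).map
        ((infinitesimalNeighbourhood.toSpec I f m).appLE ⊤ U le_top).hom := by
  rw [← ker_fibreRingHom I q hI m]
  exact ker_app_eq_map_of_isPullback_specMap (CommRingCat.ofHom (fibreRingHom I q hI m))
    (fun b => by obtain ⟨a, rfl⟩ := hq b; exact ⟨Ideal.Quotient.mk _ a, rfl⟩) (isPullback_fibreEmb I f q hI hsq m) U

end Fibre

/-! ## D4: the ideal of the fibre of a closed subscheme -/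

section IdealTransport

variable {A : Type} [CommRing A] (I : Ideal A) {X : Scheme.{0}} (f : X ⟶ Spec (.of A)) {k₀ : Type} [CommRing k₀] (q : A →+* k₀)
  (hI : I ≤ RingHom.ker q) {X₀ : Scheme.{0}} {j₀ : X₀ ⟶ X} {t₀ : X₀ ⟶ Spec (.of k₀)}
  (hsq : IsPullback j₀ t₀ f (Spec.map (CommRingCat.ofHom q))) (m : ℕ)
  {Ym Y₀ : Scheme.{0}} {jn : Ym ⟶ infinitesimalNeighbourhood I f m} {ι : Y₀ ⟶ X₀} {s₀ : Y₀ ⟶ Ym}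
  (hs₀ : IsPullback s₀ ι (jn ≫ infinitesimalNeighbourhood.ι I f m) j₀)

include hs₀ in
/-- **`Y₀ = Yₘ ×_{X_m} X₀`** from J1's square `Y₀ = Yₘ ×_X X₀` (the closed immersion `X_m ↪ X` is a monomorphism). [folklore] -/
theorem isPullback_fibreEmb_of_isPullback_ι : IsPullback s₀ ι jn (fibreEmb I f q hI hsq m) := by
  -- cancel the monomorphism `ι I f m : X_m ↪ X` in the square `hs₀` (cf. the tree's `IsPullback.of_comp_mono'`, inlined to keep the import closure small)
  have h : IsPullback s₀ ι (jn ≫ infinitesimalNeighbourhood.ι I f m) (fibreEmb I f q hI hsq m ≫ infinitesimalNeighbourhood.ι I f m) := by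
    rw [fibreEmb_ι]; exact hs₀
  have w : s₀ ≫ jn = ι ≫ fibreEmb I f q hI hsq m :=
    (cancel_mono (infinitesimalNeighbourhood.ι I f m)).mp (by simpa only [Category.assoc] using h.w)
  refine IsPullback.of_isLimit' ⟨w⟩ (PullbackCone.IsLimit.mk _
    (fun c => h.lift c.fst c.snd (by rw [← Category.assoc, c.condition, Category.assoc]))
    (fun c => h.lift_fst _ _ _) (fun c => h.lift_snd _ _ _) (fun c g h₁ h₂ => ?_))
  exact h.hom_ext (by rw [h₁, h.lift_fst]) (by rw [h₂, h.lift_snd])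

include hs₀ in
/-- **The ideal of `Y₀` in `X₀` is the pull-back of the ideal of `Yₘ` in `X_m`**: `jn.ker.comap (fibreEmb m) = ι.ker`. [folklore] -/
theorem ker_comap_fibreEmb [IsClosedImmersion jn] : jn.ker.comap (fibreEmb I f q hI hsq m) = ι.ker :=
  ker_comap_eq_of_isPullback (isPullback_fibreEmb_of_isPullback_ι I f q hI hsq m hs₀)

include hs₀ in
/-- **D4 on charts**: `(jn.ker.ideal U)·Γ(X₀, fibreEmb⁻¹U) = 𝓘_{Y₀ ⊆ X₀}(fibreEmb⁻¹U)` for every affine chart `U ⊆ X_m` (`q` surjective).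
[cite: GortzWedhorn2020, Example 4.36 (p. 139)] -/
theorem map_app_fibreEmb_eq_ker_ideal [IsClosedImmersion jn] (hq : Function.Surjective q) (U : (infinitesimalNeighbourhood I f m).affineOpens) :
    haveI := isClosedImmersion_fibreEmb I f q hI hsq hq m
    (jn.ker.ideal U).map ((fibreEmb I f q hI hsq m).app (U : (infinitesimalNeighbourhood I f m).Opens)).hom =
      ι.ker.ideal ⟨fibreEmb I f q hI hsq m ⁻¹ᵁ (U : (infinitesimalNeighbourhood I f m).Opens), U.2.preimage (fibreEmb I f q hI hsq m)⟩ := by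
  haveI := isClosedImmersion_fibreEmb I f q hI hsq hq m
  rw [Scheme.Hom.app_eq_appLE]
  exact (comap_ideal_chart (fibreEmb I f q hI hsq m) jn.ker U).symm.trans (by rw [ker_comap_fibreEmb I f q hI hsq m hs₀])

end IdealTransport

/-! ## Topology: opens of the ambient with prescribed trace along a closed immersion -/

section Trace

variable {X Y : Scheme.{0}} (e : Y ⟶ X) [IsClosedImmersion e]

/-- **The largest open of `X` with trace `O` along the closed immersion `e`**: `X ∖ e(Y ∖ O)`. [folklore] -/
def complOpens (O : Y.Opens) : X.Opens :=
  ⟨(e.base '' ((O : Set Y)ᶜ))ᶜ, (e.isClosedEmbedding.isClosedMap _ O.2.isClosed_compl).isOpen_compl⟩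

/-- Membership in `complOpens e O`. [folklore] -/
theorem mem_complOpens_iff (O : Y.Opens) (x : X) : x ∈ complOpens e O ↔ x ∉ e.base '' ((O : Set Y)ᶜ) := Iff.rfl

/-- The trace of `complOpens e O` on `Y` is `O` (`e` injective). [folklore] -/
theorem preimage_complOpens (O : Y.Opens) : e ⁻¹ᵁ complOpens e O = O := by
  ext y
  change e.base y ∈ (e.base '' ((O : Set Y)ᶜ))ᶜ ↔ y ∈ (O : Set Y)
  rw [Set.mem_compl_iff, e.isClosedEmbedding.injective.mem_set_image, Set.mem_compl_iff, not_not]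

/-- Points off the image of `e` lie in every `complOpens e O`. [folklore] -/
theorem mem_complOpens_of_not_mem_range (O : Y.Opens) {x : X} (hx : x ∉ Set.range e.base) : x ∈ complOpens e O := by
  rw [mem_complOpens_iff]
  rintro ⟨y, -, rfl⟩
  exact hx ⟨y, rfl⟩

/-- `e y ∈ complOpens e O` for `y ∈ O`. [folklore] -/
theorem base_mem_complOpens {O : Y.Opens} {y : Y} (hy : y ∈ O) : e.base y ∈ complOpens e O := by
  rw [mem_complOpens_iff]
  rintro ⟨y', hy', h⟩
  exact hy' (e.isClosedEmbedding.injective h ▸ hy)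

/-- **Every point of `X` lies in some `complOpens e (V j)` when the `V j` cover `Y`.** [folklore] -/
theorem exists_mem_complOpens {J : Type*} (V : J → Y.Opens) (hV : ⨆ j, V j = ⊤) [Nonempty J] (x : X) : ∃ j, x ∈ complOpens e (V j) := by
  by_cases hx : x ∈ Set.range e.base
  · obtain ⟨y, rfl⟩ := hx
    have hy : y ∈ ⨆ j, V j := by rw [hV]; trivial
    obtain ⟨j, hj⟩ := Opens.mem_iSup.mp hy
    exact ⟨j, base_mem_complOpens e hj⟩
  · exact ⟨Classical.arbitrary J, mem_complOpens_of_not_mem_range e _ hx⟩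

end Trace

end Summit.ResolutionOfSingularities.ResolutionOfSingularities.Cruxes.EquisingularLiftNat.Sections

end
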